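/- Width seat `ym-line-cbag-p1-w2` (prover-ym-line-cbag-p1-w2-g4-0), route `ColdBoxAllGroups`, crux `BulkAllGroups`
(stmt-QuantumFields-22255, CLOSED proved): hypothesis audit of the BULK half — simplicity of `G` is idle. -/
import Summits.QuantumFields.YangMills.Theorems.ColdBoxAllGroupsBulkAllGroupsStubDlrAssemblyG
import Summits.QuantumFields.YangMills.Theorems.ColdBoxAllGroupsBulkAllGroupsStubLargeFieldRarityG
import Summits.QuantumFields.YangMills.Theorems.ColdBoxAllGroupsBulkAllGroupsMeanSmoothOfExpansionG
import Summits.QuantumFields.YangMills.Theorems.ColdBoxAllGroupsBulkAllGroupsCovStableOfExpansionG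
import Summits.QuantumFields.YangMills.Theorems.ColdBoxAllGroupsBulkAllGroupsFlatCovOfDomAbsG
import Summits.QuantumFields.YangMills.Theorems.ColdBoxAllGroupsBulkAllGroupsBoxPolyFloorGOfBox
import Summits.QuantumFields.YangMills.Theorems.ColdBoxAllGroupsBulkAllGroupsStubKernelCovExpansionG
import Summits.QuantumFields.YangMills.Theorems.ColdBoxAllGroupsBulkAllGroupsStubKernelMeanExpansionG
import Summits.QuantumFields.YangMills.Theorems.WeakCouplingRatesBulkDominatesColdBoxWStubDirKernelTwoPoint
import Summits.QuantumFields.YangMills.Theorems.WeakCouplingRatesBulkDominatesColdBoxWDirKernelDiagFlat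

/-!
# Route `ColdBoxAllGroups`, BULK half WITHOUT simplicity: torus-versus-cold-box covariance domination for every compact group
# presented faithfully in `U(N)` with positive chart dimension

Hypothesis audit of the proved crux `BulkAllGroups` (stmt-QuantumFields-22255, `BulkAllGroups_proof`): in the whole line
`dlr-chessboard-G` the hypothesis `IsCompactSimpleLieGroup G` is consumed at exactly TWO places — `0 < D = dimE r.ρ`
(`dimE_pos_of_isCompactSimpleLieGroup`, in N2-cov-G and in L1a-G's `1 ≤ D`) and `r.N ≠ 0` (`latticeRep_N_ne_zero`, in N2-mean-G) —
and `0 < dimE ρ` already forces `N ≠ 0` (`neZero_of_dimE_pos`).  Every other ingredient (the datum layer, the kernel expansions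
`kernelCovExpansionG_of_le` / `kernelMeanExpansionG_of_bounds` / `eventually_kernelDatum_boundsG`, the reductions R1-G/R2-G, the chessboard
L2-G `stub_largeFieldRarityG`, the DLR assembly L3-G `stub_dlrAssemblyG`, the FLOOR) is stated for an arbitrary faithful continuous unitary
`ρ : G →* U(N)` of a compact `G`.  This file records the audit as theorems:
* `kernelMeanExpansionG_of_dimE_pos` — N2-mean-G at the level of `ρ` with `0 < dimE ρ` in place of simplicity (`θ ≤ 1/200`; the body is
  the registered stub's, verbatim);
* `goodBoundaryCovStable_of_dimE_pos`, `goodBoundaryMeanSmooth_of_dimE_pos` — L1a-G / L1b-G for such `ρ`, the former from the shared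
  absolute flat-datum comparison `habs` (the conclusion of S2 for this `ρ`, proved without simplicity in
  `ColdBoxAllGroupsBoxFloorDimEPos.boxDirichletDominationAbs_of_rep`, taken here as a hypothesis so that the two files are independent);
* `bulkDominatesBox_of_dimE_pos` — BULK for every compact `G` (any Borel structure), every `r : LatticeRep G` with `0 < dimE r.ρ`, given a
  BOX ceiling `θB` (every `0 < A < θ ≤ θB` has some `c > 0` with `BoxTwoPointDomination r.ρ A θ c`) and `habs`: for every `θ₀ > 0` there
  are `0 < A < θ ≤ θ₀` with `BulkDominatesBox r.ρ A θ` — the composition of `BulkAllGroups_proof` verbatim.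
Both hypotheses are discharged for every such `(G, r)` in `ColdBoxAllGroupsXiPowDimEPos` (BOX at `θB = 1/100`, `habs` at `κ = 9θ`).
So the BULK half of the rung R2xi-G, like the BOX half, never sees non-abelian structure.  No sorry; no new definition; standard axioms.
NOT a claim about the Yang–Mills mass gap (rung-level support of a RECORD-label rung; no summit statement is touched).
-/

set_option autoImplicit false

noncomputable section

namespace Summit.QuantumFields.YangMills.Theorems.ColdBoxAllGroups

open MeasureTheory ProbabilityTheory Finset Real Filter Topology Metric
open Literature.MathematicalPhysics Literature.MathematicalPhysics.QuantumFieldTheory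
open Literature.MathematicalPhysics.QuantumLattice
open Summit.QuantumFields.YangMills.Theorems.WeakCouplingRates
open Summit.QuantumFields.YangMills.Theorems.FreeEnergyLogCoefficient

section Rep

variable {N : ℕ} {G : Type} [Group G] [TopologicalSpace G] [IsTopologicalGroup G] [CompactSpace G]
  [MeasurableSpace G] [BorelSpace G] (ρ : G →* Matrix (Fin N) (Fin N) ℂ)

/-- **N2-mean-G without simplicity**: for a faithful continuous unitary `ρ : G →* U(N)` of a compact `G` with `0 < dimE ρ` and
`0 < θ ≤ 1/200`, `KernelMeanExpansionG ρ θ (θ/5)` — `kernelMeanExpansionG_of_bounds` with its numeric hypothesis discharged by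
`eventually_kernelDatum_boundsG`, exactly as in the registered stub `stub_kernelMeanExpansionG`, whose only use of simplicity was `N ≠ 0`
(here `neZero_of_dimE_pos`). -/
theorem kernelMeanExpansionG_of_dimE_pos (hρc : Continuous ρ) (hinj : Function.Injective ρ)
    (hρu : ∀ g, ρ g ∈ Matrix.unitaryGroup (Fin N) ℂ) (hD : 0 < dimE ρ) {θ : ℝ} (hθ : 0 < θ) (hθ2 : θ ≤ 1 / 200) :
    KernelMeanExpansionG ρ θ (θ / 5) := by
  haveI : NeZero N := neZero_of_dimE_pos ρ hρc hinj hD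
  refine kernelMeanExpansionG_of_bounds ρ hρc hinj hρu hθ (by linarith) ?_
  intro Ca CE r₂ C₂ η₀ hCa hCE hr₂ hC₂ hη₀
  filter_upwards [eventually_kernelDatum_boundsG N (dimE ρ) hCa hCE hr₂ hC₂ hη₀ hθ hθ2] with β h
  obtain ⟨hβ1, -, hL, hm4, hmr, hmEm, hwin, hP, -, hmean⟩ := h
  have hβ0 : 0 < β := by linarith
  have hRp : Real.sqrt β * Real.sqrt (CE * (2 * (⌈β ^ θ⌉₊ : ℝ) + 3) ^ 4 * β ^ (2 * (θ / 5) - 1)) =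
      Real.sqrt (β * (CE * (2 * (⌈β ^ θ⌉₊ : ℝ) + 3) ^ 4 * β ^ (2 * (θ / 5) - 1))) := (Real.sqrt_mul hβ0.le _).symm
  rw [hRp] at hmEm hwin hmean
  -- `r ≤ m = 2·(12H²+2H+1)(√2·√(β^{2ε−1}) + 8r)`
  have hX : 0 ≤ Ca * β ^ (3 * θ + θ / 5 - 1 / 2) := by positivity
  have hS : 0 ≤ Real.sqrt 2 * Real.sqrt (β ^ (2 * (6 * θ) - 1)) := by positivity
  have hP1 : (1 : ℝ) ≤ 12 * (⌈β ^ θ⌉₊ : ℝ) ^ 2 + 2 * (⌈β ^ θ⌉₊ : ℝ) + 1 := by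
    have : (0 : ℝ) ≤ (⌈β ^ θ⌉₊ : ℝ) := Nat.cast_nonneg _
    nlinarith
  have h1 : Real.sqrt 2 * Real.sqrt (β ^ (2 * (6 * θ) - 1)) + 8 * (Ca * β ^ (3 * θ + θ / 5 - 1 / 2)) ≤
      (12 * (⌈β ^ θ⌉₊ : ℝ) ^ 2 + 2 * (⌈β ^ θ⌉₊ : ℝ) + 1) *
        (Real.sqrt 2 * Real.sqrt (β ^ (2 * (6 * θ) - 1)) + 8 * (Ca * β ^ (3 * θ + θ / 5 - 1 / 2))) :=
    le_mul_of_one_le_left (by positivity) hP1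
  have hrm : Ca * β ^ (3 * θ + θ / 5 - 1 / 2) ≤
      2 * ((12 * (⌈β ^ θ⌉₊ : ℝ) ^ 2 + 2 * (⌈β ^ θ⌉₊ : ℝ) + 1) *
        (Real.sqrt 2 * Real.sqrt (β ^ (2 * (6 * θ) - 1)) + 8 * (Ca * β ^ (3 * θ + θ / 5 - 1 / 2)))) := by linarith
  exact ⟨hβ1, hL, hm4, hmr, hmEm, hrm, hwin, hP, hmean⟩

/-- **L1a-G without simplicity — deep kernel covariances are stable under crude-good data**, for a faithful continuous unitary
`ρ : G →* U(N)` of a compact `G` with `0 < dimE ρ`, given the absolute flat-datum comparison `habs` for this `ρ` (S2's conclusion):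
reduction R1-G `goodBoundaryCovStableG_of_kernelCovExpansionG` fed with N2-cov-G `kernelCovExpansionG_of_le` (`0 < dimE ρ`), N2-flat-G
`flatCovExpansionG_of_domAbsG habs` and the group-free N1 `stub_dirKernelTwoPoint`. -/
theorem goodBoundaryCovStable_of_dimE_pos (hρc : Continuous ρ) (hinj : Function.Injective ρ)
    (hρu : ∀ g, ρ g ∈ Matrix.unitaryGroup (Fin N) ℂ) (hD : 0 < dimE ρ)
    (habs : ∃ θ₀ : ℝ, 0 < θ₀ ∧ ∀ θ : ℝ, 0 < θ → θ ≤ θ₀ → ∃ κ : ℝ, 8 * θ < κ ∧ ∃ β₀ : ℝ, ∀ β : ℝ, β₀ ≤ β →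
      ∀ T : ℕ, T ≤ ⌈β ^ θ⌉₊ →
        |β ^ 2 * boxPlaqCov ρ β ⌈β ^ θ⌉₊ T - (dimE ρ : ℝ) / 4 * boxDirCircSqCov ⌈β ^ θ⌉₊ T| ≤ β ^ (-κ)) :
    ∃ θa : ℝ, 0 < θa ∧ ∀ θ : ℝ, 0 < θ → θ ≤ θa → ∃ η₁ : ℝ, 0 < η₁ ∧ GoodBoundaryCovStableG ρ (θ / 20) θ (θ / 5) η₁ := by
  haveI : SecondCountableTopology (Matrix (Fin N) (Fin N) ℂ) := inferInstanceAs (SecondCountableTopology (Fin N → Fin N → ℂ))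
  haveI : SecondCountableTopology G := (hρc.isClosedEmbedding hinj).isEmbedding.secondCountableTopology
  exact goodBoundaryCovStableG_of_kernelCovExpansionG ρ (Nat.succ_le_of_lt hD)
    ⟨1 / 200, by norm_num, fun θ hθ hθ2 => kernelCovExpansionG_of_le ρ hρc hinj hρu hD hθ hθ2⟩
    (flatCovExpansionG_of_domAbsG ρ habs) stub_dirKernelTwoPoint

/-- **L1b-G without simplicity — deep kernel means are position-smooth under crude-good data**, for a faithful continuous unitary
`ρ : G →* U(N)` of a compact `G` with `0 < dimE ρ`: reduction R2-G `goodBoundaryMeanSmoothG_of_kernelMeanExpansionG` fed with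
`kernelMeanExpansionG_of_dimE_pos` and the group-free N1′ `dirKernelDiagFlat`. -/
theorem goodBoundaryMeanSmooth_of_dimE_pos (hρc : Continuous ρ) (hinj : Function.Injective ρ)
    (hρu : ∀ g, ρ g ∈ Matrix.unitaryGroup (Fin N) ℂ) (hD : 0 < dimE ρ) :
    ∃ θb : ℝ, 0 < θb ∧ ∀ θ : ℝ, 0 < θ → θ ≤ θb → GoodBoundaryMeanSmoothG ρ (θ / 20) θ (θ / 5) :=
  goodBoundaryMeanSmoothG_of_kernelMeanExpansionG ρ
    ⟨1 / 200, by norm_num, fun _ hθ hθ2 => kernelMeanExpansionG_of_dimE_pos ρ hρc hinj hρu hD hθ hθ2⟩ dirKernelDiagFlat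

end Rep

/-- **BULK without simplicity — torus-versus-cold-box covariance domination for every compact group with a faithful unitary lattice
representation of positive chart dimension.**  For every compact `G` (any Borel structure) and `r : LatticeRep G` with `0 < dimE r.ρ`,
given a BOX ceiling `θB > 0` (for all `0 < A < θ ≤ θB` some `c > 0` has `BoxTwoPointDomination r.ρ A θ c`) and the absolute flat-datum
comparison `habs` for `r.ρ`: for every `θ₀ > 0` there are exponents `0 < A < θ ≤ θ₀` with `BulkDominatesBox r.ρ A θ`.  The proof is the
composition `BulkAllGroups_proof` verbatim — `θ = min θ₀ θa θb θk`, `(A, δ, K) = (θ/20, θ/5, 2 + θ/2)`, L3-G `stub_dlrAssemblyG` applied to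
L1a-G, L1b-G (this file), L2-G `stub_largeFieldRarityG` and L4-G `boxPolyFloorG_of_boxTwoPointDomination hbox` (`θk = θB`). -/
theorem bulkDominatesBox_of_dimE_pos (G : Type) [Group G] [TopologicalSpace G] [IsTopologicalGroup G] [CompactSpace G]
    [MeasurableSpace G] [BorelSpace G] (r : LatticeRep G) (hD : 0 < dimE r.ρ) {θB : ℝ} (hθB : 0 < θB)
    (hbox : ∀ A θ : ℝ, 0 < A → A < θ → θ ≤ θB → ∃ c : ℝ, 0 < c ∧ BoxTwoPointDomination r.ρ A θ c)
    (habs : ∃ θ₀ : ℝ, 0 < θ₀ ∧ ∀ θ : ℝ, 0 < θ → θ ≤ θ₀ → ∃ κ : ℝ, 8 * θ < κ ∧ ∃ β₀ : ℝ, ∀ β : ℝ, β₀ ≤ β →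
      ∀ T : ℕ, T ≤ ⌈β ^ θ⌉₊ →
        |β ^ 2 * boxPlaqCov r.ρ β ⌈β ^ θ⌉₊ T - (dimE r.ρ : ℝ) / 4 * boxDirCircSqCov ⌈β ^ θ⌉₊ T| ≤ β ^ (-κ)) :
    ∀ θ₀ : ℝ, 0 < θ₀ → ∃ A θ : ℝ, 0 < A ∧ A < θ ∧ θ ≤ θ₀ ∧ BulkDominatesBox r.ρ A θ := by
  intro θ₀ hθ₀
  obtain ⟨θa, hθa, ha⟩ := goodBoundaryCovStable_of_dimE_pos r.ρ r.continuous r.injective r.mem_unitary hD habs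
  obtain ⟨θb, hθb, hb⟩ := goodBoundaryMeanSmooth_of_dimE_pos r.ρ r.continuous r.injective r.mem_unitary hD
  set θ : ℝ := min θ₀ (min θa (min θb θB)) with hθdef
  have hθpos : 0 < θ := lt_min hθ₀ (lt_min hθa (lt_min hθb hθB))
  have hθ0 : θ ≤ θ₀ := min_le_left _ _
  have hθa' : θ ≤ θa := le_trans (min_le_right _ _) (min_le_left _ _)
  have hθb' : θ ≤ θb := le_trans (min_le_right _ _) (le_trans (min_le_right _ _) (min_le_left _ _))
  have hθk' : θ ≤ θB := le_trans (min_le_right _ _) (le_trans (min_le_right _ _) (min_le_right _ _))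
  obtain ⟨η₁, hη, h1a'⟩ := ha θ hθpos hθa'
  refine ⟨θ / 20, θ, by positivity, by linarith, hθ0, ?_⟩
  exact stub_dlrAssemblyG G r (θ / 20) θ (θ / 5) η₁ (2 + θ / 2) (by positivity) (by positivity) hη (by linarith) h1a'
    (hb θ hθpos hθb') (stub_largeFieldRarityG G r (θ / 5) (by positivity))
    (boxPolyFloorG_of_boxTwoPointDomination r.ρ hbox hθpos hθk')

end Summit.QuantumFields.YangMills.Theorems.ColdBoxAllGroups

end
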